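import Summits.QuantumAdvantage.QuantumAdvantage.Theorems.MobiusLadderLiouvilleOrthogonalTC0LtfCombination
import Summits.QuantumAdvantage.QuantumAdvantage.Theorems.MobiusLadderLiouvilleOrthogonalTC0SpectralLevel
import HarnessLib

/-!
# Crux `MobiusLadder.LiouvilleOrthogonalTC0` (stmt-QuantumAdvantage-1393): Boolean combinations of
polynomially many threshold tests — a depth-two rung with small top fan-in, unconditionally

Line `Sketch` (lead `prover-line-stmt-QuantumAdvantage-1393-c2-0`). The uniform bound
`W^{≥ m}[sgn ∘ h ∘ (L_1,…,L_k)] ≤ 3(k+1)/√m` (`LtfCombination.tailWeight_ltf_combination_le`) balanced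
against the level `⌊n^{1/R}⌋₊ + 1` of the single-level spectral criterion
(`liouville_orthogonal_of_tailWeight_level`, `R = ⌈3/c⌉₊`): with `k ≤ n^{1/(4R)}` the tail at that
level is `≤ 6 n^{-1/(4R)} → 0`.

* `liouville_orthogonal_ltf_combination_poly` — there is `α > 0` such that for every `ε > 0`,
  eventually in `n`, for every `k ≤ n^α`, every `h : {0,1}^k → {0,1}` and all integer threshold tests
  `L_a(N) = [θ_a ≤ Σ_i w_{a,i} bit_i(N)]`, `|Σ_{N<2ⁿ} λ(N) sgn h(L_1(N),…,L_k(N))| ≤ ε 2ⁿ`.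

In circuit terms: `λ` is orthogonal to every depth-two threshold circuit (`MAJ/∧/∨` of `MAJ/∧/∨`
gates of literals, unbounded bottom fan-in) whose OUTPUT gate has fan-in `≤ n^α` — e.g. a majority of
`n^α` majorities. (Registered stub `stub_ltfCombinationPoly`.)
-/

set_option linter.dupNamespace false -- D-0017: single-problem summit ⇒ `QuantumAdvantage.QuantumAdvantage` by design

noncomputable section

namespace Summit.QuantumAdvantage.QuantumAdvantage.Theorems.LiouvilleOrthogonalTC0

open Filter Finset Topology
open Literature.Computability.Complexity
open Literature.Computability.Complexity.LowDegree (tailWeight)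
open Literature.Probability.RandomGraphs.LowDegree (sgn)
open Literature.NumberTheory.Sieve

/-- **`λ` is orthogonal to every Boolean combination of `≤ n^α` linear threshold tests of the binary
digits** (unconditional): there is `α > 0` such that for every `ε > 0`, for all sufficiently large
`n`, for every `k` with `k ≤ n^α`, every `h : {0,1}^k → {0,1}` and all integer tests
`L_a(N) = [θ_a ≤ Σ_i w_{a,i} bit_i(N)]` satisfy `|Σ_{N<2ⁿ} λ(N) · sgn h(L_1(N), …, L_k(N))| ≤ ε · 2ⁿ`. -/
theorem liouville_orthogonal_ltf_combination_poly : ∃ α : ℝ, 0 < α ∧ ∀ ε : ℝ, 0 < ε →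
    ∀ᶠ n : ℕ in atTop, ∀ k : ℕ, (k : ℝ) ≤ (n : ℝ) ^ α →
      ∀ (h : (Fin k → Bool) → Bool) (w : Fin k → Fin n → ℤ) (θ : Fin k → ℤ),
        |∑ N ∈ Finset.range (2 ^ n), ((ArithmeticFunction.liouville N : ℤ) : ℝ) *
            sgn (h (fun l => decide (θ l ≤ ∑ i, w l i * (if Nat.testBit N i then (1 : ℤ) else 0))))|
          ≤ ε * (2 : ℝ) ^ n := by
  obtain ⟨c, hc, hB⟩ := bourgain_liouville_walsh_holds
  set R : ℕ := ⌈(3 : ℝ) / c⌉₊ with hRdef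
  have hR1 : 1 ≤ R := by
    have : (0 : ℝ) < 3 / c := by positivity
    exact Nat.one_le_iff_ne_zero.mpr (Nat.pos_iff_ne_zero.mp (Nat.ceil_pos.mpr this))
  have hRc : 3 ≤ (R : ℝ) * c := by
    have h1 : (3 : ℝ) / c ≤ R := Nat.le_ceil _
    have := mul_le_mul_of_nonneg_right h1 hc.le
    rwa [div_mul_cancel₀ _ hc.ne'] at this
  have hRpos : (0 : ℝ) < R := by exact_mod_cast (show 0 < R by omega)
  refine ⟨1 / (4 * R), by positivity, fun ε hε => ?_⟩
  have hε3 : 0 < (ε / 3) ^ 2 := by positivity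
  -- `6 n^{-1/(4R)} ≤ (ε/3)²` eventually
  have hdec : Tendsto (fun n : ℕ => 6 * (n : ℝ) ^ (-(1 / (4 * (R : ℝ))))) atTop (𝓝 0) := by
    have h := (tendsto_rpow_neg_atTop (show (0 : ℝ) < 1 / (4 * R) by positivity)).comp
      tendsto_natCast_atTop_atTop
    simpa using h.const_mul (6 : ℝ)
  filter_upwards [liouville_orthogonal_of_tailWeight_level hc hB hR1 hRc ε hε,
    hdec.eventually_le_const hε3, eventually_ge_atTop 1] with n hn hsmall hn1 k hk h w θ
  refine hn (fun y => h (fun l => decide (θ l ≤ ∑ i, w l i * (if y i then (1 : ℤ) else 0)))) ?_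
  set kk : ℕ := ⌊((n : ℝ)) ^ ((1 : ℝ) / R)⌋₊ with hkkdef
  have hnpos : (0 : ℝ) < n := by exact_mod_cast hn1
  have htail := LtfCombination.tailWeight_ltf_combination_le h w θ (m := kk + 1) (by omega)
  refine htail.trans (le_trans ?_ hsmall)
  -- `3(k+1)/√(kk+1) ≤ 6 n^α / n^{1/(2R)} = 6 n^{-1/(4R)}`
  have hk1 : (n : ℝ) ^ ((1 : ℝ) / R) < (kk : ℝ) + 1 := Nat.lt_floor_add_one _
  have hsqrt : (n : ℝ) ^ ((1 : ℝ) / (2 * R)) ≤ Real.sqrt ((kk : ℝ) + 1) := by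
    have h1 : Real.sqrt ((n : ℝ) ^ ((1 : ℝ) / R)) ≤ Real.sqrt ((kk : ℝ) + 1) :=
      Real.sqrt_le_sqrt hk1.le
    have h2 : Real.sqrt ((n : ℝ) ^ ((1 : ℝ) / R)) = (n : ℝ) ^ ((1 : ℝ) / (2 * R)) := by
      rw [Real.sqrt_eq_rpow, ← Real.rpow_mul hnpos.le]
      congr 1
      field_simp
    rw [← h2]; exact h1
  have hpow_pos : (0 : ℝ) < (n : ℝ) ^ ((1 : ℝ) / (2 * R)) := Real.rpow_pos_of_pos hnpos _
  have hone : (1 : ℝ) ≤ (n : ℝ) ^ ((1 : ℝ) / (4 * R)) :=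
    Real.one_le_rpow (by exact_mod_cast hn1) (by positivity)
  have hnum : 3 * ((k : ℝ) + 1) ≤ 6 * (n : ℝ) ^ ((1 : ℝ) / (4 * R)) := by nlinarith
  have hcast : ((kk + 1 : ℕ) : ℝ) = (kk : ℝ) + 1 := by push_cast; ring
  rw [hcast]
  calc 3 * ((k : ℝ) + 1) / Real.sqrt ((kk : ℝ) + 1)
      ≤ 6 * (n : ℝ) ^ ((1 : ℝ) / (4 * R)) / (n : ℝ) ^ ((1 : ℝ) / (2 * R)) := by
        gcongr
    _ = 6 * (n : ℝ) ^ (-(1 / (4 * (R : ℝ)))) := by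
        rw [mul_div_assoc, ← Real.rpow_sub hnpos]
        congr 2
        field_simp
        ring

/-- **Registered stub `stub_ltfCombinationPoly`**: verbatim `liouville_orthogonal_ltf_combination_poly`. -/
theorem stub_ltfCombinationPoly : ∃ α : ℝ, 0 < α ∧ ∀ ε : ℝ, 0 < ε → ∀ᶠ n : ℕ in atTop, ∀ k : ℕ, (k : ℝ) ≤ (n : ℝ) ^ α → ∀ (h : (Fin k → Bool) → Bool) (w : Fin k → Fin n → ℤ) (θ : Fin k → ℤ), |∑ N ∈ Finset.range (2 ^ n), ((ArithmeticFunction.liouville N : ℤ) : ℝ) * sgn (h (fun l => decide (θ l ≤ ∑ i, w l i * (if Nat.testBit N i then (1 : ℤ) else 0))))| ≤ ε * (2 : ℝ) ^ n :=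
  liouville_orthogonal_ltf_combination_poly

end Summit.QuantumAdvantage.QuantumAdvantage.Theorems.LiouvilleOrthogonalTC0
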